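import Mathlib
import HarnessLib
import Summits.ResolutionOfSingularities.ResolutionOfSingularities.Theorems.HomologicalConductorPersistenceKC3Witness

/-!
# K-C3, object K4d (definitions): `W₀ = k[a,b,c]^{μ₆(1,2,3)}` and its base `P₀ = k[a⁶, b³, c²]`

Route `ResolutionOfSingularities/HomologicalConductor`, chain W4.4b, crux `Persistence`
(stmt-ResolutionOfSingularities-16484), KILL CANDIDATE K-C3 (res-L1-w44b-plan-1 K5 AMENDMENT
2026-08-27T12:34:43Z (B) «037 TAKES K4d», interface endorsed 13:03:18Z (4)).  [OURS · L1 w44b ·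
res-D-pv-037 gen 9; AI-written and AI-reviewed only (weaker than expert review); NOT a statement of the
manuscript under study.]  The all-levels device `…PersistenceFrobeniusOrderSyzygy.lean` (p530841) consumes
a Frobenius-order structure; this file fixes the rings, in the model res-D-pv-058's witness `kc3D` lives in:
* `kc3W k` — `W₀ = k[a⁶, a⁴b, a³c, a²b², abc, c², b³] ⊆ k[a,b,c]` (`a, b, c = X 0, X 1, X 2`), the chain's
  W-model of record VERBATIM; `mem_kc3W_iff` — closed form: support on the index-6 lattice `6 ∣ i+2j+3l`
  (Hilbert-basis induction `monomial_mem_kc3W_of_wt_dvd`);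
* `kc3P k` — `P₀ = k[a⁶, b³, c²]` as a SUBALGEBRA of `k[a,b,c]`, `mem_kc3P_iff` (support on `6ℕ×3ℕ×2ℕ`),
  `kc3P_le_kc3W`, the `↥P₀`-algebra structure `kc3W.algebraP` on `↥W₀` by inclusion (`coe_smul_kc3P`),
  `kc3W.isNoetherianRing`.  (Base ring = the subalgebra, NOT the abstract `k[A,B,C]`: otherwise Mathlib's
  `Subalgebra.moduleLeft` would manufacture a second `↥W₀`-action on every `k[a,b,c]`-module and
  `IsScalarTower` synthesis would pick the wrong one.)  `kc3θ : k[A,B,C] →ₐ[k] k[a,b,c]`, `A ↦ a⁶, B ↦ b³,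
  C ↦ c²` (`kc3θ_monomial`, `coeff_sc_kc3θ`, `kc3θ_injective`, `kc3θ_mem_kc3P`) identifies `k[A,B,C]`
  with `P₀`.
The `P₀`-basis of `W₀`, the Frobenius form and `k[A,B,C] ≃ₐ P₀` are in `…KC3FrobeniusOrderBasis.lean`; the
Gram identity and the K5 sockets in `…KC3FrobeniusOrder.lean`.
-/
noncomputable section

-- single-problem summit: the doubled namespace component `ResolutionOfSingularities` is forced
set_option linter.dupNamespace false

open MvPolynomial

universe u

namespace Summit.ResolutionOfSingularities.ResolutionOfSingularities.Theorems.HomologicalConductor.KC3FrobeniusOrder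

open Summit.ResolutionOfSingularities.ResolutionOfSingularities.Theorems.HomologicalConductor.KC3Witness (e e_apply_zero e_apply_one e_apply_two e_add e_zero)

variable (k : Type u) [Field k]

/-! ## The index-6 lattice and the invariant ring `W₀` -/

/-- The `μ₆(1,2,3)`-weight of an exponent `(i, j, l)`: `i + 2j + 3l`; the invariant monomials of
`k[a,b,c]` are those of weight divisible by `6` (the index-6 lattice). [OURS · L1 w44b] -/
def wt (d : Fin 3 →₀ ℕ) : ℕ := d 0 + 2 * d 1 + 3 * d 2

variable {k} in
/-- The weight is additive. [folklore] -/
theorem wt_add (d d' : Fin 3 →₀ ℕ) : wt (d + d') = wt d + wt d' := by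
  simp only [wt, Finsupp.coe_add, Pi.add_apply]
  ring

/-- `W₀ = k[a⁶, a⁴b, a³c, a²b², abc, c², b³] ⊆ k[a,b,c]` — the ring of invariants of `μ₆(1,2,3)`, as
the subalgebra generated by the Hilbert basis of the index-6 lattice (`a, b, c = X 0, X 1, X 2`),
spelled LITERALLY as the chain's W-model of record (res-L1-w44b-plan-1 2026-08-27T12:34:43Z (B)).
[OURS · L1 w44b; K-C3 arrival ring, REFEREE-KC3 L4] -/
def kc3W : Subalgebra k (MvPolynomial (Fin 3) k) :=
  Algebra.adjoin k {X 0 ^ 6, X 0 ^ 4 * X 1, X 0 ^ 3 * X 2, X 0 ^ 2 * X 1 ^ 2, X 0 * X 1 * X 2,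
    X 2 ^ 2, X 1 ^ 3}

variable {k}

/-- The seven generators as monomials. [OURS · bookkeeping] -/
theorem kc3Gens_eq :
    ({X 0 ^ 6, X 0 ^ 4 * X 1, X 0 ^ 3 * X 2, X 0 ^ 2 * X 1 ^ 2, X 0 * X 1 * X 2, X 2 ^ 2, X 1 ^ 3} :
      Set (MvPolynomial (Fin 3) k)) =
    {monomial (e 6 0 0) 1, monomial (e 4 1 0) 1, monomial (e 3 0 1) 1,
      monomial (e 2 2 0) 1, monomial (e 1 1 1) 1, monomial (e 0 0 2) 1, monomial (e 0 3 0) 1} := by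
  simp only [e, X, monomial_pow, monomial_mul, one_pow, mul_one, Finsupp.smul_single, smul_eq_mul,
    Finsupp.single_zero, add_zero, zero_add]

/-- `W₀` as the subalgebra generated by the seven monomials. [OURS · bookkeeping] -/
theorem kc3W_eq_adjoin_monomial : kc3W k =
    Algebra.adjoin k {monomial (e 6 0 0) 1, monomial (e 4 1 0) 1, monomial (e 3 0 1) 1,
      monomial (e 2 2 0) 1, monomial (e 1 1 1) 1, monomial (e 0 0 2) 1, monomial (e 0 3 0) 1} := by
  rw [kc3W, kc3Gens_eq]

/-- Every element of `W₀` is supported on the index-6 lattice. [OURS · L1 w44b] -/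
theorem wt_dvd_of_mem_kc3W {p : MvPolynomial (Fin 3) k} (hp : p ∈ kc3W k) :
    ∀ d ∈ p.support, 6 ∣ wt d := by
  classical
  rw [kc3W_eq_adjoin_monomial] at hp
  induction hp using Algebra.adjoin_induction with
  | mem x hx =>
    simp only [Set.mem_insert_iff, Set.mem_singleton_iff] at hx
    intro d hd
    rcases hx with rfl | rfl | rfl | rfl | rfl | rfl | rfl <;>
    · rw [support_monomial, if_neg one_ne_zero, Finset.mem_singleton] at hd
      subst hd
      simp [wt, e]
  | algebraMap r =>
    intro d hd
    rw [algebraMap_eq] at hd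
    have : d = 0 := by
      by_contra h
      exact (mem_support_iff.mp hd) (by rw [coeff_C, if_neg (Ne.symm h)])
    subst this
    simp [wt]
  | add x y _ _ hx hy =>
    intro d hd
    rcases Finset.mem_union.mp (support_add hd) with h | h
    · exact hx d h
    · exact hy d h
  | mul x y _ _ hx hy =>
    intro d hd
    obtain ⟨d₁, hd₁, d₂, hd₂, rfl⟩ := Finset.mem_add.mp (support_mul x y hd)
    rw [wt_add]
    exact dvd_add (hx d₁ hd₁) (hy d₂ hd₂)

/-- The seven generators `a⁶, a⁴b, a³c, a²b², abc, c², b³` (as monomials) lie in `W₀`. [OURS] -/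
theorem monomial_gens_mem_kc3W :
    monomial (e 6 0 0) (1 : k) ∈ kc3W k ∧ monomial (e 4 1 0) (1 : k) ∈ kc3W k ∧
      monomial (e 3 0 1) (1 : k) ∈ kc3W k ∧ monomial (e 2 2 0) (1 : k) ∈ kc3W k ∧
      monomial (e 1 1 1) (1 : k) ∈ kc3W k ∧ monomial (e 0 0 2) (1 : k) ∈ kc3W k ∧
      monomial (e 0 3 0) (1 : k) ∈ kc3W k := by
  have hgen : ∀ (p q r : ℕ), monomial (e p q r) (1 : k) ∈
      ({monomial (e 6 0 0) 1, monomial (e 4 1 0) 1, monomial (e 3 0 1) 1, monomial (e 2 2 0) 1,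
        monomial (e 1 1 1) 1, monomial (e 0 0 2) 1, monomial (e 0 3 0) 1} :
        Set (MvPolynomial (Fin 3) k)) → monomial (e p q r) (1 : k) ∈ kc3W k :=
    fun p q r h => by rw [kc3W_eq_adjoin_monomial]; exact Algebra.subset_adjoin h
  exact ⟨hgen 6 0 0 (Or.inl rfl), hgen 4 1 0 (Or.inr (Or.inl rfl)),
    hgen 3 0 1 (Or.inr (Or.inr (Or.inl rfl))), hgen 2 2 0 (Or.inr (Or.inr (Or.inr (Or.inl rfl)))),
    hgen 1 1 1 (Or.inr (Or.inr (Or.inr (Or.inr (Or.inl rfl))))),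
    hgen 0 0 2 (Or.inr (Or.inr (Or.inr (Or.inr (Or.inr (Or.inl rfl)))))),
    hgen 0 3 0 (Or.inr (Or.inr (Or.inr (Or.inr (Or.inr (Or.inr rfl))))))⟩

/-- Peeling: `monomial (d + g) c = monomial d c * monomial g 1` inherits membership. [OURS] -/
theorem monomial_add_mem_kc3W {d g : Fin 3 →₀ ℕ} (c : k) (h1 : monomial d c ∈ kc3W k)
    (h2 : monomial g (1 : k) ∈ kc3W k) : monomial (d + g) c ∈ kc3W k := by
  have : monomial (d + g) c = monomial d c * monomial g (1 : k) := by rw [monomial_mul, mul_one]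
  rw [this]
  exact mul_mem h1 h2

/-- `monomial g c = c • monomial g 1` inherits membership. [OURS · bookkeeping] -/
theorem monomial_mem_kc3W_of_one {g : Fin 3 →₀ ℕ} (c : k) (hg : monomial g (1 : k) ∈ kc3W k) :
    monomial g c ∈ kc3W k := by
  have : monomial g c = c • monomial g (1 : k) := by rw [smul_monomial, smul_eq_mul, mul_one]
  rw [this]
  exact (kc3W k).smul_mem hg c

/-- An exponent below `(6,3,2)` on the lattice is one of the six boxes. [OURS · bookkeeping] -/
theorem box_cases (i j l : ℕ) (hi : i < 6) (hj : j < 3) (hl : l < 2) (h : 6 ∣ i + 2 * j + 3 * l) :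
    (i = 0 ∧ j = 0 ∧ l = 0) ∨ (i = 4 ∧ j = 1 ∧ l = 0) ∨ (i = 2 ∧ j = 2 ∧ l = 0) ∨
      (i = 3 ∧ j = 0 ∧ l = 1) ∨ (i = 1 ∧ j = 1 ∧ l = 1) ∨ (i = 5 ∧ j = 2 ∧ l = 1) := by
  interval_cases j <;> interval_cases l <;> omega

/-- The six box monomials `1, a⁴b, a²b², a³c, abc, a⁵b²c` lie in `W₀`. [OURS · bookkeeping] -/
theorem monomial_box_mem_kc3W (c : k) :
    monomial (e 0 0 0) c ∈ kc3W k ∧ monomial (e 4 1 0) c ∈ kc3W k ∧ monomial (e 2 2 0) c ∈ kc3W k ∧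
      monomial (e 3 0 1) c ∈ kc3W k ∧ monomial (e 1 1 1) c ∈ kc3W k ∧
      monomial (e 5 2 1) c ∈ kc3W k := by
  obtain ⟨-, h410, h301, h220, h111, -, -⟩ := (monomial_gens_mem_kc3W (k := k))
  refine ⟨?_, monomial_mem_kc3W_of_one c h410, monomial_mem_kc3W_of_one c h220,
    monomial_mem_kc3W_of_one c h301, monomial_mem_kc3W_of_one c h111, ?_⟩
  · rw [e_zero, ← C_apply]; exact (kc3W k).algebraMap_mem c
  · rw [show e 5 2 1 = e 4 1 0 + e 1 1 1 by rw [e_add]]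
    exact monomial_add_mem_kc3W c (monomial_mem_kc3W_of_one c h410) h111

set_option maxHeartbeats 400000 in
/-- **Hilbert basis of the index-6 lattice**: every lattice monomial lies in `W₀` (induction on the
exponent: peel off `c²`, `b³`, `a⁶`, then the six box monomials). [OURS · L1 w44b] -/
theorem monomial_mem_kc3W_of_wt_dvd :
    ∀ (n : ℕ) (d : Fin 3 →₀ ℕ), d 0 + d 1 + d 2 ≤ n → 6 ∣ wt d → ∀ c : k, monomial d c ∈ kc3W k := by
  obtain ⟨h600, -, -, -, -, h002, h030⟩ := (monomial_gens_mem_kc3W (k := k))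
  intro n
  induction n with
  | zero =>
    intro d hd _ c
    have h0 : d = 0 := by
      ext i; fin_cases i <;> simp <;> omega
    subst h0
    rw [← C_apply]; exact (kc3W k).algebraMap_mem c
  | succ n ih =>
    intro d hd hL c
    have hd_eq : d = e (d 0) (d 1) (d 2) := by ext i; fin_cases i <;> simp
    simp only [wt] at hL
    by_cases h2 : 2 ≤ d 2
    · have : d = e (d 0) (d 1) (d 2 - 2) + e 0 0 2 := by
        rw [e_add]; ext i
        fin_cases i <;> simp
        omega
      rw [this]
      refine monomial_add_mem_kc3W c (ih _ ?_ ?_ c) h002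
      · simp; omega
      · simp [wt]; omega
    by_cases h1 : 3 ≤ d 1
    · have : d = e (d 0) (d 1 - 3) (d 2) + e 0 3 0 := by
        rw [e_add]; ext i
        fin_cases i <;> simp
        omega
      rw [this]
      refine monomial_add_mem_kc3W c (ih _ ?_ ?_ c) h030
      · simp; omega
      · simp [wt]; omega
    by_cases h0 : 6 ≤ d 0
    · have : d = e (d 0 - 6) (d 1) (d 2) + e 6 0 0 := by
        rw [e_add]; ext i
        fin_cases i <;> simp
        omega
      rw [this]
      refine monomial_add_mem_kc3W c (ih _ ?_ ?_ c) h600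
      · simp; omega
      · simp [wt]; omega
    obtain ⟨hb0, hb1, hb2, hb3, hb4, hb5⟩ := monomial_box_mem_kc3W (k := k) c
    rw [hd_eq]
    rcases box_cases (d 0) (d 1) (d 2) (by omega) (by omega) (by omega) hL with
      ⟨h₀, h₁, h₂⟩ | ⟨h₀, h₁, h₂⟩ | ⟨h₀, h₁, h₂⟩ | ⟨h₀, h₁, h₂⟩ | ⟨h₀, h₁, h₂⟩ | ⟨h₀, h₁, h₂⟩ <;>
      rw [h₀, h₁, h₂]
    exacts [hb0, hb1, hb2, hb3, hb4, hb5]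

/-- **Closed form of `W₀`**: a polynomial lies in `W₀ = k[a⁶, a⁴b, a³c, a²b², abc, c², b³]` iff its
support lies on the index-6 lattice `6 ∣ i + 2j + 3l`. [OURS · L1 w44b] -/
theorem mem_kc3W_iff {p : MvPolynomial (Fin 3) k} : p ∈ kc3W k ↔ ∀ d ∈ p.support, 6 ∣ wt d := by
  refine ⟨wt_dvd_of_mem_kc3W, fun h => ?_⟩
  rw [as_sum p]
  exact Subalgebra.sum_mem _ fun d hd =>
    monomial_mem_kc3W_of_wt_dvd _ d le_rfl (h d hd) _
/-- Lattice monomials lie in `W₀`. [OURS · L1 w44b] -/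
theorem monomial_mem_kc3W {d : Fin 3 →₀ ℕ} (hd : 6 ∣ wt d) (c : k) : monomial d c ∈ kc3W k :=
  monomial_mem_kc3W_of_wt_dvd _ d le_rfl hd c

/-! ## `P₀ = k[A,B,C] → W₀`, `A ↦ a⁶, B ↦ b³, C ↦ c²` -/

/-- Exponent scaling `(i, j, l) ↦ (6i, 3j, 2l)`. [OURS · bookkeeping] -/
def sc (q : Fin 3 →₀ ℕ) : Fin 3 →₀ ℕ := e (6 * q 0) (3 * q 1) (2 * q 2)

/-- First component of a scaled exponent. [OURS · bookkeeping] -/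
@[simp] theorem sc_apply_zero (q : Fin 3 →₀ ℕ) : sc q 0 = 6 * q 0 := by simp [sc]
/-- Second component of a scaled exponent. [OURS · bookkeeping] -/
@[simp] theorem sc_apply_one (q : Fin 3 →₀ ℕ) : sc q 1 = 3 * q 1 := by simp [sc]
/-- Third component of a scaled exponent. [OURS · bookkeeping] -/
@[simp] theorem sc_apply_two (q : Fin 3 →₀ ℕ) : sc q 2 = 2 * q 2 := by simp [sc]
/-- Scaled exponents lie on the lattice. [OURS · bookkeeping] -/
theorem wt_sc_dvd (q : Fin 3 →₀ ℕ) : 6 ∣ wt (sc q) := by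
  simp only [wt, sc_apply_zero, sc_apply_one, sc_apply_two]; omega

/-- `sc` is injective. [OURS · bookkeeping] -/
theorem sc_injective : Function.Injective sc := fun q q' h => by
  have h0 := congrArg (· 0) h; have h1 := congrArg (· 1) h; have h2 := congrArg (· 2) h
  simp only [sc_apply_zero, sc_apply_one, sc_apply_two] at h0 h1 h2
  ext i; fin_cases i <;> simp <;> omega

variable (k) in
/-- `θ : k[A,B,C] → k[a,b,c]`, `A ↦ a⁶, B ↦ b³, C ↦ c²` (onto `P₀ = k[a⁶,b³,c²]`). [OURS · L1 w44b] -/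
def kc3θ : MvPolynomial (Fin 3) k →ₐ[k] MvPolynomial (Fin 3) k := aeval ![X 0 ^ 6, X 1 ^ 3, X 2 ^ 2]

/-- `θ` on monomials: `θ (A^i B^j C^l) = a^{6i} b^{3j} c^{2l}`. [OURS · bookkeeping] -/
theorem kc3θ_monomial (q : Fin 3 →₀ ℕ) (c : k) : kc3θ k (monomial q c) = monomial (sc q) c := by
  rw [kc3θ, aeval_monomial, monomial_eq, Finsupp.prod_pow, Finsupp.prod_pow, Fin.prod_univ_three,
    Fin.prod_univ_three, algebraMap_eq]
  simp only [Matrix.cons_val_zero, Matrix.cons_val_one, Matrix.cons_val_two, Matrix.tail_cons,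
    Matrix.head_cons, sc_apply_zero, sc_apply_one, sc_apply_two, pow_mul]

/-- Coefficients of `θ p` on the scaled lattice are those of `p`. [OURS · bookkeeping] -/
theorem coeff_sc_kc3θ (p : MvPolynomial (Fin 3) k) (q : Fin 3 →₀ ℕ) :
    coeff (sc q) (kc3θ k p) = coeff q p := by
  induction p using MvPolynomial.induction_on' with
  | monomial d a =>
    rw [kc3θ_monomial, coeff_monomial, coeff_monomial]
    by_cases h : d = q
    · subst h; simp
    · rw [if_neg (fun h' => h (sc_injective h')), if_neg h]
  | add p q hp hq => simp only [map_add, coeff_add, hp, hq]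

/-- Coefficients of `θ p` off the sublattice `6ℕ × 3ℕ × 2ℕ` vanish. [OURS · bookkeeping] -/
theorem coeff_kc3θ_eq_zero (p : MvPolynomial (Fin 3) k) (d : Fin 3 →₀ ℕ)
    (hd : ¬ (6 ∣ d 0 ∧ 3 ∣ d 1 ∧ 2 ∣ d 2)) : coeff d (kc3θ k p) = 0 := by
  induction p using MvPolynomial.induction_on' with
  | monomial q a =>
    rw [kc3θ_monomial, coeff_monomial, if_neg]
    rintro rfl
    exact hd ⟨⟨q 0, by simp⟩, ⟨q 1, by simp⟩, ⟨q 2, by simp⟩⟩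
  | add p q hp hq => simp only [map_add, coeff_add, hp, hq, add_zero]

/-- `θ` is injective. [OURS · bookkeeping] -/
theorem kc3θ_injective : Function.Injective (kc3θ k) := fun p p' h => by
  ext q
  rw [← coeff_sc_kc3θ p q, ← coeff_sc_kc3θ p' q, h]

/-! ## `P₀ = k[a⁶, b³, c²] ⊆ W₀` and the `P₀`-algebra structure on `W₀` -/

variable (k) in
/-- `P₀ = k[a⁶, b³, c²] ⊆ k[a,b,c]` — a polynomial ring on three algebraically independent monomials,
the base of the Frobenius order `W₀`. [OURS · L1 w44b] -/
def kc3P : Subalgebra k (MvPolynomial (Fin 3) k) := Algebra.adjoin k {X 0 ^ 6, X 1 ^ 3, X 2 ^ 2}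

/-- The three generators of `P₀` as monomials. [OURS · bookkeeping] -/
theorem kc3PGens_eq : ({X 0 ^ 6, X 1 ^ 3, X 2 ^ 2} : Set (MvPolynomial (Fin 3) k)) =
    {monomial (e 6 0 0) 1, monomial (e 0 3 0) 1, monomial (e 0 0 2) 1} := by
  simp only [e, X, monomial_pow, one_pow, Finsupp.smul_single, smul_eq_mul, mul_one,
    Finsupp.single_zero, add_zero, zero_add]

/-- Every element of `P₀` is supported on `6ℕ × 3ℕ × 2ℕ`. [OURS · L1 w44b] -/
theorem dvd_of_mem_kc3P {p : MvPolynomial (Fin 3) k} (hp : p ∈ kc3P k) :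
    ∀ d ∈ p.support, 6 ∣ d 0 ∧ 3 ∣ d 1 ∧ 2 ∣ d 2 := by
  classical
  rw [kc3P, kc3PGens_eq] at hp
  induction hp using Algebra.adjoin_induction with
  | mem x hx =>
    simp only [Set.mem_insert_iff, Set.mem_singleton_iff] at hx
    intro d hd
    rcases hx with rfl | rfl | rfl <;>
    · rw [support_monomial, if_neg one_ne_zero, Finset.mem_singleton] at hd
      subst hd
      simp [e]
  | algebraMap r =>
    intro d hd
    rw [algebraMap_eq] at hd
    have : d = 0 := by
      by_contra h
      exact (mem_support_iff.mp hd) (by rw [coeff_C, if_neg (Ne.symm h)])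
    subst this
    simp
  | add x y _ _ hx hy =>
    intro d hd
    rcases Finset.mem_union.mp (support_add hd) with h | h
    · exact hx d h
    · exact hy d h
  | mul x y _ _ hx hy =>
    intro d hd
    obtain ⟨d₁, hd₁, d₂, hd₂, rfl⟩ := Finset.mem_add.mp (support_mul x y hd)
    obtain ⟨h0, h1, h2⟩ := hx d₁ hd₁
    obtain ⟨h0', h1', h2'⟩ := hy d₂ hd₂
    simp only [Finsupp.coe_add, Pi.add_apply]
    exact ⟨dvd_add h0 h0', dvd_add h1 h1', dvd_add h2 h2'⟩

/-- Scaled monomials `a^{6i} b^{3j} c^{2l}` lie in `P₀`. [OURS · L1 w44b] -/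
theorem monomial_sc_mem_kc3P (q : Fin 3 →₀ ℕ) (c : k) : monomial (sc q) c ∈ kc3P k := by
  rw [← kc3θ_monomial, kc3θ, aeval_monomial, algebraMap_eq]
  refine mul_mem (by rw [← algebraMap_eq]; exact (kc3P k).algebraMap_mem c) ?_
  rw [Finsupp.prod_pow, Fin.prod_univ_three]
  simp only [Matrix.cons_val_zero, Matrix.cons_val_one, Matrix.cons_val_two, Matrix.tail_cons,
    Matrix.head_cons]
  refine mul_mem (mul_mem (pow_mem ?_ _) (pow_mem ?_ _)) (pow_mem ?_ _) <;>
    refine Algebra.subset_adjoin ?_ <;>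
    simp only [Set.mem_insert_iff, Set.mem_singleton_iff, true_or, or_true]

/-- **Closed form of `P₀`**: a polynomial lies in `k[a⁶, b³, c²]` iff its support lies on
`6ℕ × 3ℕ × 2ℕ`. [OURS · L1 w44b] -/
theorem mem_kc3P_iff {p : MvPolynomial (Fin 3) k} :
    p ∈ kc3P k ↔ ∀ d ∈ p.support, 6 ∣ d 0 ∧ 3 ∣ d 1 ∧ 2 ∣ d 2 := by
  refine ⟨dvd_of_mem_kc3P, fun h => ?_⟩
  rw [as_sum p]
  refine Subalgebra.sum_mem _ fun d hd => ?_
  obtain ⟨⟨u, hu⟩, ⟨v, hv⟩, ⟨w, hw⟩⟩ := h d hd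
  have : d = sc (e u v w) := by ext i; fin_cases i <;> simp [sc, e, hu, hv, hw]
  rw [this]
  exact monomial_sc_mem_kc3P _ _

/-- `θ` lands in `P₀` (indeed onto it). [OURS · L1 w44b] -/
theorem kc3θ_mem_kc3P (p : MvPolynomial (Fin 3) k) : kc3θ k p ∈ kc3P k := by
  classical
  rw [mem_kc3P_iff]
  intro d hd
  by_contra hL
  exact mem_support_iff.mp hd (coeff_kc3θ_eq_zero p d hL)

/-- `P₀ ⊆ W₀`. [OURS · L1 w44b] -/
theorem kc3P_le_kc3W : kc3P k ≤ kc3W k := by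
  rw [kc3P]
  refine Algebra.adjoin_le ?_
  rintro x hx
  simp only [Set.mem_insert_iff, Set.mem_singleton_iff] at hx
  rcases hx with rfl | rfl | rfl <;> refine Algebra.subset_adjoin ?_ <;>
    simp only [Set.mem_insert_iff, Set.mem_singleton_iff, true_or, or_true]

variable (k) in
/-- **The `P₀`-algebra structure on `W₀`** by the inclusion `P₀ = k[a⁶,b³,c²] ⊆ W₀`.
[OURS · L1 w44b] -/
instance kc3W.algebraP : Algebra ↥(kc3P k) ↥(kc3W k) :=
  (Subalgebra.inclusion kc3P_le_kc3W).toRingHom.toAlgebra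

/-- The structure map is the inclusion. [OURS · L1 w44b] -/
theorem coe_algebraMap_kc3P (p : ↥(kc3P k)) :
    ((algebraMap ↥(kc3P k) ↥(kc3W k) p : ↥(kc3W k)) : MvPolynomial (Fin 3) k) =
      (p : MvPolynomial (Fin 3) k) :=
  Subalgebra.coe_inclusion kc3P_le_kc3W p

/-- Scalar multiplication by `P₀` inside `k[a,b,c]`: `↑(p • w) = ↑p * ↑w`. [OURS · L1 w44b] -/
theorem coe_smul_kc3P (p : ↥(kc3P k)) (w : ↥(kc3W k)) :
    ((p • w : ↥(kc3W k)) : MvPolynomial (Fin 3) k) =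
      (p : MvPolynomial (Fin 3) k) * (w : MvPolynomial (Fin 3) k) := by
  rw [Algebra.smul_def, Subalgebra.coe_mul, coe_algebraMap_kc3P]

/-- `k → P₀ → W₀` is a scalar tower. [OURS · L1 w44b] -/
instance kc3W.isScalarTower : IsScalarTower k ↥(kc3P k) ↥(kc3W k) :=
  IsScalarTower.of_algebraMap_eq fun c => Subtype.ext (by
    rw [coe_algebraMap_kc3P, Subalgebra.coe_algebraMap, Subalgebra.coe_algebraMap])

/-- `W₀` is a noetherian ring (a finitely generated algebra over a field). [folklore] -/
instance kc3W.isNoetherianRing : IsNoetherianRing ↥(kc3W k) := by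
  have h : (kc3W k).FG := Subalgebra.fg_def.mpr
    ⟨_, ((((((Set.finite_singleton _).insert _).insert _).insert _).insert _).insert _).insert _, rfl⟩
  exact isNoetherianRing_of_fg h

end Summit.ResolutionOfSingularities.ResolutionOfSingularities.Theorems.HomologicalConductor.KC3FrobeniusOrder

end
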